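import Mathlib
import Summits.Ventures.PercRepro2.Defs
import Summits.Ventures.PercRepro2.Graph
import Summits.Ventures.PercRepro2.Harris
import Summits.Ventures.PercRepro2.RowC1Cross
import Summits.Ventures.PercRepro2.RowC1CrossIdentity

/-!
# The cross term of row 2′C1 at the edge `a₁a₂` vanishes (blind cell PercRepro2, p2 g34;
proofs/P2-G34-ROOT.md §6)

With the edge `e = a₁a₂` open the roots are connected, so `Q = {a₁ ↮ a₂}` is null under `p[e↦1]`
(`prob_update_one_Q_eq_zero`) and every `P¹`-mass of the cross term vanishes:
`c1Cross p e = 0` (`c1Cross_eq_zero_of_a₁a₂_edge`, via `c1Cross_eq_zero_of_mul_eq_zero`).  Hence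
the one-edge expansion at such an edge reads `c1Slack p = (1 − p e)² · c1Slack p[e↦0]`: the row
at a fractional root–root edge follows from the row with that edge deleted.  Std axioms.
-/

namespace Summit.Ventures.PercRepro2

namespace RowC1

section RootPair

variable {V : Type*} {E : Type*} [Fintype E] [DecidableEq E] [Fintype V] [DecidableEq V]
  {R : Type*} [Field R] [LinearOrder R] [IsStrictOrderedRing R]

omit [Fintype E] [DecidableEq E] [Fintype V] [DecidableEq V] [Field R] [LinearOrder R]
  [IsStrictOrderedRing R] in
/-- With `e = a₁a₂` open, `a₁ ↔ a₂`: `Q ∩ openEdge e = ∅`. -/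
lemma Q_inter_openEdge_eq_empty (ends : E → Sym2 V) {e : E} {a₁ a₂ : V}
    (hends : ends e = s(a₁, a₂)) :
    (connEvent ends a₁ a₂)ᶜ ∩ openEdge e = ∅ := by
  ext ω
  simp only [Set.mem_inter_iff, Set.mem_compl_iff, mem_connEvent, mem_openEdge, Set.mem_empty_iff_false,
    iff_false, not_and]
  intro hQ he
  exact hQ (conn_of_openAdj ⟨e, he, hends⟩)

omit [Fintype V] [DecidableEq V] [LinearOrder R] [IsStrictOrderedRing R] in
/-- Under `p[e↦1]` with `e = a₁a₂`, `Q` is null. -/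
lemma prob_update_one_Q_eq_zero (p : E → R) (ends : E → Sym2 V) {e : E} {a₁ a₂ : V}
    (hends : ends e = s(a₁, a₂)) :
    prob (Function.update p e (1 : R)) (connEvent ends a₁ a₂)ᶜ = 0 := by
  rw [← prob_update_one_inter_openEdge p _ e, Q_inter_openEdge_eq_empty ends hends, prob_empty]

omit [Fintype V] [DecidableEq V] in
/-- **The cross term at the edge `a₁a₂` vanishes.** -/
theorem c1Cross_eq_zero_of_a₁a₂_edge (p : E → R) (hp : IsProbVec p) (ends : E → Sym2 V) {e : E}
    {a₁ a₂ : V} (hends : ends e = s(a₁, a₂)) (o b : V) :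
    c1Cross p ends a₁ a₂ o b e = 0 := by
  apply c1Cross_eq_zero_of_mul_eq_zero p hp ends a₁ a₂ o b e
  rw [prob_update_one_Q_eq_zero p ends hends, mul_zero]

omit [Fintype V] [DecidableEq V] in
/-- At the edge `a₁a₂` the one-edge expansion reads `c1Slack p = (1 − p e)² · c1Slack p[e↦0]`. -/
theorem c1Slack_eq_of_a₁a₂_edge (p : E → R) (hp : IsProbVec p) (ends : E → Sym2 V) {e : E}
    {a₁ a₂ : V} (hends : ends e = s(a₁, a₂)) (o b : V) :
    c1Slack p ends a₁ a₂ o b =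
      (1 - p e) ^ 2 * c1Slack (Function.update p e (0 : R)) ends a₁ a₂ o b := by
  have h := c1Slack_eq_pin p ends a₁ a₂ o b e
  rw [c1Cross_eq_zero_of_a₁a₂_edge p hp ends hends o b, mul_zero, add_zero] at h
  have h1 : c1Slack (Function.update p e (1 : R)) ends a₁ a₂ o b = 0 := by
    unfold c1Slack
    rw [prob_update_one_Q_eq_zero p ends hends]
    have hB := prob_Q_sub_eq_zero p hp ends a₁ a₂ e 1 zero_le_one le_rfl
      (prob_update_one_Q_eq_zero p ends hends)
      ((connEvent ends a₁ o ∪ connEvent ends a₂ o) ∩ (connEvent ends a₁ b ∪ connEvent ends a₂ b))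
    have hC := prob_Q_sub_eq_zero p hp ends a₁ a₂ e 1 zero_le_one le_rfl
      (prob_update_one_Q_eq_zero p ends hends) (connEvent ends a₂ b)
    rw [hB, hC]
    ring
  rw [h1, mul_zero, add_zero] at h
  exact h

end RootPair

end RowC1

end Summit.Ventures.PercRepro2
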